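import Mathlib
import HarnessLib
import Literature.Analysis.FunctionSpaces.ParametricIntegralSmooth
import Summits.HubbardSuperconductivity.HubbardSuperconductivity.Theorems.KLProgrammeC4aBubbleTubeDeriv

/-!
# Route `KLProgramme` — crux C4a, S3 brick (B3, ALL ORDERS): the base-angle derivatives of the co-moving bubble's loop and level integrals
# exist AT EVERY ORDER and are the integrals of the integrand's jets; `θ ↦ I(e;θ)` and `(e,θ) ↦ f(e)·I(e;θ)` are `C^∞`

Cell `gate-hubbard-kl`, seat hubbard-kl-k3c3-p3 (g24; row «implicit-function / monotonicity route»).  Located brick «(B3)-ALL-ORDERS» for the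
(C)-closer lane (stub (C) `stub_twoLeg_curvature` of `KLRegimeEngineV17F2`, stmt-HubbardSuperconductivity-20437; c4a-1 C4A-PLAN §24.9 (iii) / §24.11
«NEXT: (B3) completion — ph twin + outer e-integral + orders 2–4»).  After `…C4aBubbleTubeRep` the tube piece of the co-moving pp bubble is
`∫_{(−r,r)} f(e)·I(e;θ) de`, `I(e;θ) = ∫_{(−π,π)} J(e,φ+θ)·Ψ(ē(e,φ;ρ′,ϑ′,θ)) dφ`, `ē = e_K(Φ(0,θ) + Φ(ρ′,ϑ′+θ) − Φ(e,φ+θ))`; `…C4aBubbleTubeDeriv`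
differentiated `I` ONCE by hand (dominators `klJacG₁M₀ + klJacG₀·3K₁D₁·M₁`).  Here the same is done AT EVERY ORDER, with no order-by-order dominators,
by iterating the tree's one-derivative parametric-integral lemma for JOINTLY SMOOTH integrands on a compact range
(`Literature.Analysis.FunctionSpaces.fderiv_parametric_integral_apply`):

* §1 (carrier-free, any finite measure on `W`, values in a compact `K`) **`iteratedDeriv_parametric_integral_eq`** — `∂ᵏ_θ ∫ G(ι w, θ) dν =
  ∫ ∂ᵏ_θ[G(ι w, ·)](θ) dν` for `G : V × ℝ → F` of class `C^∞`, every `k`; `norm_iteratedDeriv_parametric_integral_le` (majorants pass under the integral);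
  loop-circle / level-interval specialisations `iteratedDeriv_loopCircleIntegral_eq`, `contDiff_loopCircleIntegral(_param)`, `norm_iteratedDeriv_loopCircleIntegral_le(_const)`,
  `iteratedDeriv_levelIntervalIntegral_eq`; the strip lemma `contDiff_mul_of_tsupport_subset_strip` (level profile supported inside the open tube × a map smooth on the tube).
* §2 (pp) `contDiff_loopIntegrand_pp`, **`iteratedDeriv_loopIntegral_pp_eq`** (`∂ᵏ_θ I(e;θ) = ∫ ∂ᵏ_θ[J(e,φ+θ)•Ψ(ē)](θ) dφ`, every `k`), `contDiff_loopIntegral_pp`,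
  `norm_iteratedDeriv_loopIntegral_pp_le`; `contDiff_levelIntegrand_pp`, `contDiff_levelLoopIntegral_pp` (`(e,θ) ↦ f(e)·I(e;θ)` jointly `C^∞`),
  **`iteratedDeriv_levelIntegral_pp_eq`** (`∂ᵏ_θ ∫ f(e)·I(e;θ) de = ∫ f(e)·∫ ∂ᵏ_θ[J•Ψ(ē)] dφ de`), `contDiff_levelIntegral_pp`.
* §3 the ph twins (partner `Φ(e,φ+θ) − (Φ(0,θ) − Φ(ρ′,ϑ′+θ))`).

The integrand's jets are priced by `…C4aCompositeJetCounting` (one small factor of `ē`'s jets per Faà di Bruno block); the n-free estimates are (B4).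
Measure-theoretic bookkeeping on landed objects, generic `BandBounds a b` window; nothing about the model's sizes; nothing asserts superconductivity.
References: Hörmander, *ALPDO I* Thm. 1.1.9 (differentiation under the integral sign) [folklore, tree: `Literature.Analysis.FunctionSpaces.ParametricIntegralSmooth`];
FST II CPAM 51 (1998) §3; BGM 2006 §2.4 (2.40) [cite: BenfattoGiulianiMastropietro2006].
-/

noncomputable section

namespace Summit.HubbardSuperconductivity.HubbardSuperconductivity.Theorems.C4a

set_option linter.dupNamespace false -- summit = problem name (single-conjunct summit), D-0017

open Real Set Filter MeasureTheory Metric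
open scoped Topology ContDiff
open Literature.MathematicalPhysics.QuantumLattice Literature.MathematicalPhysics.QuantumLattice.BandSectorCounting Literature.Probability.LatticeModels
open Summit.HubbardSuperconductivity.HubbardSuperconductivity.Theorems.KLRegimeSplit
open Summit.HubbardSuperconductivity.HubbardSuperconductivity.Theorems.DispersionFlow
open Summit.HubbardSuperconductivity.HubbardSuperconductivity.Theorems.PerturbedFermiCurve

/-! ## §1 All-orders differentiation under a finite-measure integral, one real parameter -/

section Parametric

variable {W : Type*} [MeasurableSpace W] {ν : Measure W} [IsFiniteMeasure ν]
variable {V : Type*} [NormedAddCommGroup V] [NormedSpace ℝ V] [SecondCountableTopology V] [MeasurableSpace V] [BorelSpace V]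
variable {F : Type*} [NormedAddCommGroup F] [NormedSpace ℝ F]

omit [SecondCountableTopology V] [MeasurableSpace V] [BorelSpace V] in
/-- The derivative of a section `θ ↦ G(y, θ)` of a `C¹` map on `V × ℝ` is the partial Fréchet derivative on `(0, 1)`. [folklore] -/
theorem deriv_section_eq_fderiv {G : V × ℝ → F} {n : WithTop ℕ∞} (hG : ContDiff ℝ n G) (hn : n ≠ 0) (y : V) (θ : ℝ) :
    deriv (fun θ : ℝ => G (y, θ)) θ = fderiv ℝ G (y, θ) ((0 : V), (1 : ℝ)) := by
  have h := (Literature.Analysis.FunctionSpaces.hasFDerivAt_comp_prodMk_right hG hn y θ).hasDerivAt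
  rw [h.deriv, ContinuousLinearMap.comp_apply, ContinuousLinearMap.inr_apply]

omit [SecondCountableTopology V] [MeasurableSpace V] [BorelSpace V] in
/-- The partial derivative `q ↦ DG(q)(0,1)` of a `C^∞` map is `C^∞`. [folklore] -/
theorem contDiff_fderiv_apply_section {G : V × ℝ → F} (hG : ContDiff ℝ ∞ G) :
    ContDiff ℝ ∞ fun q : V × ℝ => fderiv ℝ G q ((0 : V), (1 : ℝ)) :=
  (hG.fderiv_right (m := ∞) le_rfl).clm_apply contDiff_const

omit [SecondCountableTopology V] [MeasurableSpace V] [BorelSpace V] in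
/-- `∂ᵏ⁺¹_θ[G(y,·)] = ∂ᵏ_θ[DG(y,·)(0,1)]`. [folklore] -/
theorem iteratedDeriv_section_succ {G : V × ℝ → F} (hG : ContDiff ℝ ∞ G) (k : ℕ) (y : V) (θ : ℝ) :
    iteratedDeriv (k + 1) (fun θ : ℝ => G (y, θ)) θ = iteratedDeriv k (fun θ : ℝ => fderiv ℝ G (y, θ) ((0 : V), (1 : ℝ))) θ := by
  have h1 : (∞ : WithTop ℕ∞) ≠ 0 := by exact_mod_cast WithTop.coe_ne_zero.2 (by decide)
  rw [iteratedDeriv_succ']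
  exact congrArg (fun g : ℝ → F => iteratedDeriv k g θ) (funext fun θ' => deriv_section_eq_fderiv hG h1 y θ')

/-- **ALL-ORDERS DIFFERENTIATION UNDER THE INTEGRAL SIGN** (one real parameter; Hörmander 1.1.9): if `G : V × ℝ → F` is `C^∞`, `ι : W → V` is
measurable with values a.e. in a compact `K` and `ν` is finite, then for every `k` and `θ`
`∂ᵏ_θ (∫ G(ι w, θ) dν)(θ) = ∫ ∂ᵏ_θ[G(ι w, ·)](θ) dν`. Induction on `k`: one derivative under the integral sign
(`fderiv_parametric_integral_apply`) turns the integrand into the jointly smooth `DG(·)(0,1)`. [folklore] -/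
theorem iteratedDeriv_parametric_integral_eq {ι : W → V} (hι : Measurable ι) {K : Set V} (hK : IsCompact K) (hιK : ∀ᵐ w ∂ν, ι w ∈ K) :
    ∀ (k : ℕ) {G : V × ℝ → F}, ContDiff ℝ ∞ G → ∀ θ : ℝ,
      iteratedDeriv k (fun θ : ℝ => ∫ w, G (ι w, θ) ∂ν) θ = ∫ w, iteratedDeriv k (fun θ : ℝ => G (ι w, θ)) θ ∂ν
  | 0, G, _, θ => by simp only [iteratedDeriv_zero]
  | k + 1, G, hG, θ => by
    have h1 : (∞ : WithTop ℕ∞) ≠ 0 := by exact_mod_cast WithTop.coe_ne_zero.2 (by decide)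
    have hd : deriv (fun θ : ℝ => ∫ w, G (ι w, θ) ∂ν) = fun θ : ℝ => ∫ w, fderiv ℝ G (ι w, θ) ((0 : V), (1 : ℝ)) ∂ν := by
      funext θ'
      rw [← fderiv_apply_one_eq_deriv]
      exact Literature.Analysis.FunctionSpaces.fderiv_parametric_integral_apply hι hK hιK hG h1 θ' 1
    rw [iteratedDeriv_succ', hd, iteratedDeriv_parametric_integral_eq hι hK hιK k (contDiff_fderiv_apply_section hG) θ]
    refine integral_congr_ae (Eventually.of_forall fun w => ?_)
    exact (iteratedDeriv_section_succ hG k (ι w) θ).symm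

/-- **Majorants pass under the integral**: a pointwise integrable majorant of the integrand's `k`-jet bounds the `k`-jet of the integral. [folklore] -/
theorem norm_iteratedDeriv_parametric_integral_le {ι : W → V} (hι : Measurable ι) {K : Set V} (hK : IsCompact K) (hιK : ∀ᵐ w ∂ν, ι w ∈ K)
    {G : V × ℝ → F} (hG : ContDiff ℝ ∞ G) (k : ℕ) (θ : ℝ) {m : W → ℝ} (hmi : Integrable m ν)
    (hm : ∀ᵐ w ∂ν, ‖iteratedDeriv k (fun θ : ℝ => G (ι w, θ)) θ‖ ≤ m w) :
    ‖iteratedDeriv k (fun θ : ℝ => ∫ w, G (ι w, θ) ∂ν) θ‖ ≤ ∫ w, m w ∂ν := by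
  rw [iteratedDeriv_parametric_integral_eq hι hK hιK k hG θ]
  exact norm_integral_le_of_norm_le hmi hm

end Parametric

/-! ### §1b The loop circle `(−π, π)` and a level interval `(−r, r)` -/

section Circle

variable {F : Type*} [NormedAddCommGroup F] [NormedSpace ℝ F]

/-- The loop circle carries Lebesgue measure a.e. inside the compact `[−π, π]`. -/
theorem ae_restrict_Ioo_mem_Icc (c d : ℝ) : ∀ᵐ φ ∂(volume.restrict (Ioo c d)), (id φ : ℝ) ∈ Icc c d :=
  (ae_restrict_mem measurableSet_Ioo).mono fun _ h => Ioo_subset_Icc_self h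

/-- **Every derivative under the loop integral**: for `G : ℝ × ℝ → F` of class `C^∞`,
`∂ᵏ_θ ∫_{(−π,π)} G(φ,θ) dφ = ∫_{(−π,π)} ∂ᵏ_θ[G(φ,·)](θ) dφ`. [folklore] -/
theorem iteratedDeriv_loopCircleIntegral_eq {G : ℝ × ℝ → F} (hG : ContDiff ℝ ∞ G) (k : ℕ) (θ : ℝ) :
    iteratedDeriv k (fun θ : ℝ => ∫ φ in Ioo (-π) π, G (φ, θ)) θ = ∫ φ in Ioo (-π) π, iteratedDeriv k (fun θ : ℝ => G (φ, θ)) θ :=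
  iteratedDeriv_parametric_integral_eq (ν := volume.restrict (Ioo (-π) π)) measurable_id isCompact_Icc (ae_restrict_Ioo_mem_Icc (-π) π) k hG θ

/-- The same over a level interval `(−r, r)` (any `c < d` in fact). [folklore] -/
theorem iteratedDeriv_levelIntervalIntegral_eq (c d : ℝ) {G : ℝ × ℝ → F} (hG : ContDiff ℝ ∞ G) (k : ℕ) (θ : ℝ) :
    iteratedDeriv k (fun θ : ℝ => ∫ e in Ioo c d, G (e, θ)) θ = ∫ e in Ioo c d, iteratedDeriv k (fun θ : ℝ => G (e, θ)) θ :=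
  iteratedDeriv_parametric_integral_eq (ν := volume.restrict (Ioo c d)) measurable_id isCompact_Icc (ae_restrict_Ioo_mem_Icc c d) k hG θ

/-- The loop integral of a jointly smooth integrand is `C^∞` in the base angle. [folklore] -/
theorem contDiff_loopCircleIntegral {G : ℝ × ℝ → F} (hG : ContDiff ℝ ∞ G) : ContDiff ℝ ∞ fun θ : ℝ => ∫ φ in Ioo (-π) π, G (φ, θ) :=
  Literature.Analysis.FunctionSpaces.contDiff_parametric_integral (μ := volume.restrict (Ioo (-π) π)) measurable_id isCompact_Icc
    (ae_restrict_Ioo_mem_Icc (-π) π) hG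

/-- Two parameters: the loop integral of a jointly smooth integrand is `C^∞` in `(e, θ)`. [folklore] -/
theorem contDiff_loopCircleIntegral_param {G : ℝ × (ℝ × ℝ) → F} (hG : ContDiff ℝ ∞ G) :
    ContDiff ℝ ∞ fun p : ℝ × ℝ => ∫ φ in Ioo (-π) π, G (φ, p) :=
  Literature.Analysis.FunctionSpaces.contDiff_parametric_integral (μ := volume.restrict (Ioo (-π) π)) measurable_id isCompact_Icc
    (ae_restrict_Ioo_mem_Icc (-π) π) hG

/-- The level integral of a jointly smooth integrand is `C^∞` in the base angle. [folklore] -/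
theorem contDiff_levelIntervalIntegral (c d : ℝ) {G : ℝ × ℝ → F} (hG : ContDiff ℝ ∞ G) : ContDiff ℝ ∞ fun θ : ℝ => ∫ e in Ioo c d, G (e, θ) :=
  Literature.Analysis.FunctionSpaces.contDiff_parametric_integral (μ := volume.restrict (Ioo c d)) measurable_id isCompact_Icc
    (ae_restrict_Ioo_mem_Icc c d) hG

/-- **Majorants pass under the loop integral**, pointwise in the loop angle. [folklore] -/
theorem norm_iteratedDeriv_loopCircleIntegral_le {G : ℝ × ℝ → F} (hG : ContDiff ℝ ∞ G) (k : ℕ) (θ : ℝ) {m : ℝ → ℝ}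
    (hmi : IntegrableOn m (Ioo (-π) π)) (hm : ∀ φ ∈ Ioo (-π) π, ‖iteratedDeriv k (fun θ : ℝ => G (φ, θ)) θ‖ ≤ m φ) :
    ‖iteratedDeriv k (fun θ : ℝ => ∫ φ in Ioo (-π) π, G (φ, θ)) θ‖ ≤ ∫ φ in Ioo (-π) π, m φ :=
  norm_iteratedDeriv_parametric_integral_le (ν := volume.restrict (Ioo (-π) π)) measurable_id isCompact_Icc (ae_restrict_Ioo_mem_Icc (-π) π)
    hG k θ hmi ((ae_restrict_mem measurableSet_Ioo).mono hm)

/-- Constant majorant: `‖∂ᵏ_θ ∫_{(−π,π)} G(φ,θ) dφ‖ ≤ 2π·C`. [folklore] -/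
theorem norm_iteratedDeriv_loopCircleIntegral_le_const {G : ℝ × ℝ → F} (hG : ContDiff ℝ ∞ G) (k : ℕ) (θ : ℝ) {C : ℝ}
    (hC : ∀ φ ∈ Ioo (-π) π, ‖iteratedDeriv k (fun θ : ℝ => G (φ, θ)) θ‖ ≤ C) :
    ‖iteratedDeriv k (fun θ : ℝ => ∫ φ in Ioo (-π) π, G (φ, θ)) θ‖ ≤ 2 * π * C := by
  have h := norm_iteratedDeriv_loopCircleIntegral_le hG k θ
    ((continuous_const (y := C)).integrableOn_Icc (a := -π) (b := π) |>.mono_set Ioo_subset_Icc_self) hC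
  have hvol : ∫ _ in Ioo (-π) π, C = 2 * π * C := by
    rw [setIntegral_const, smul_eq_mul, Real.volume_real_Ioo_of_le (by linarith [pi_pos])]; ring
  rwa [hvol] at h

/-- **The strip lemma for a level profile**: if `P : X → ℂ` is `Cⁿ` at every point of the open strip `{|ℓ q| < r}` (`ℓ : X → ℝ` a `Cⁿ` level
coordinate) and `f : ℝ → ℂ` is `Cⁿ` with `tsupport f ⊆ (−r, r)`, then `q ↦ f(ℓ q)·P q` is globally `Cⁿ` (outside the strip it vanishes near every point). [folklore] -/
theorem contDiff_mul_of_tsupport_subset_strip {X : Type*} [NormedAddCommGroup X] [NormedSpace ℝ X] {ℓ : X → ℝ} {P : X → ℂ} {f : ℝ → ℂ}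
    {r : ℝ} {n : ℕ∞} (hℓ : ContDiff ℝ n ℓ) (hP : ∀ q, |ℓ q| < r → ContDiffAt ℝ n P q) (hf : ContDiff ℝ n f)
    (hsupp : tsupport f ⊆ Ioo (-r) r) : ContDiff ℝ n fun q => f (ℓ q) * P q := by
  refine contDiff_iff_contDiffAt.2 fun q => ?_
  by_cases hq : |ℓ q| < r
  · exact ((hf.contDiffAt (x := ℓ q)).comp q hℓ.contDiffAt).mul (hP q hq)
  · have hnot : ℓ q ∉ tsupport f := fun h => hq (abs_lt.2 (by simpa using hsupp h))
    have hev : f =ᶠ[𝓝 (ℓ q)] 0 := notMem_tsupport_iff_eventuallyEq.1 hnot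
    have hev' : (fun q' => f (ℓ q') * P q') =ᶠ[𝓝 q] fun _ => 0 := by
      filter_upwards [hℓ.continuous.continuousAt.eventually hev] with q' hq'
      simp only [Pi.zero_apply] at hq'
      rw [hq', zero_mul]
    exact contDiffAt_const.congr_of_eventuallyEq hev'

end Circle

/-! ## §2 The co-moving pp loop and level integrals -/

section PP

variable {a b : ℝ} (B : BandBounds a b) {K : TrigPolyC4v} {A : ℝ}
  (hA : ∀ p : Momentum, ∀ j ≤ 2, ‖iteratedFDeriv ℝ j (frameShift K) p‖ ≤ A) (hADt : 2 * A < B.Dtmin)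
  {μ r : ℝ} (hlo : a < μ - r - A) (hhi : μ + r + A < b)
include B hA hADt hlo hhi

/-- **The pp loop integrand is jointly `C^∞` in (loop angle, base angle)**: `(φ,θ) ↦ J(e,φ+θ)•Ψ(e_K(Φ(0,θ) + Φ(ρ′,ϑ′+θ) − Φ(e,φ+θ)))`
for `|e|, |ρ′| < r` and smooth `Ψ`. -/
theorem contDiff_loopIntegrand_pp {Ψ : ℝ → ℂ} (hΨ : ContDiff ℝ ∞ Ψ) {ρ' e : ℝ} (hρ' : |ρ'| < r) (he : |e| < r) (ϑ' : ℝ) :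
    ContDiff ℝ ∞ fun q : ℝ × ℝ => (levelChartJac μ K (e, q.1 + q.2) : ℝ) •
      Ψ (frameLevel μ K (levelPoint μ K 0 q.2 + levelPoint μ K ρ' (ϑ' + q.2) - levelPoint μ K e (q.1 + q.2))) := by
  have h0 : |(0 : ℝ)| < r := by rw [abs_zero]; exact (abs_nonneg e).trans_lt he
  have hJ : ContDiff ℝ ∞ fun q : ℝ × ℝ => levelChartJac μ K (e, q.1 + q.2) :=
    (contDiff_levelChartJac_angle B hA hADt hlo hhi he).comp (contDiff_fst.add contDiff_snd)
  have hl : ∀ {x : ℝ}, |x| < r → ContDiff ℝ ∞ (levelPoint μ K x) := fun hx => contDiff_levelPoint_angle B hA hADt hlo hhi hx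
  have hE : ContDiff ℝ ∞ fun q : ℝ × ℝ => levelPoint μ K 0 q.2 + levelPoint μ K ρ' (ϑ' + q.2) - levelPoint μ K e (q.1 + q.2) :=
    (((hl h0).comp contDiff_snd).add ((hl hρ').comp (contDiff_const.add contDiff_snd))).sub ((hl he).comp (contDiff_fst.add contDiff_snd))
  exact hJ.smul (hΨ.comp ((EngineV8.contDiff_frameLevel μ K).comp hE))

/-- **EVERY BASE-ANGLE DERIVATIVE OF THE CO-MOVING pp LOOP INTEGRAL IS THE INTEGRAL OF THE INTEGRAND'S JET**: for smooth `Ψ`, `|e|, |ρ′| < r`, `ϑ′`,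
every `k` and `θ`,  `∂ᵏ_θ ∫_{(−π,π)} J(e,φ+θ)•Ψ(ē) dφ = ∫_{(−π,π)} ∂ᵏ_θ[J(e,φ+θ)•Ψ(ē)](θ) dφ`. -/
theorem iteratedDeriv_loopIntegral_pp_eq {Ψ : ℝ → ℂ} (hΨ : ContDiff ℝ ∞ Ψ) {ρ' e : ℝ} (hρ' : |ρ'| < r) (he : |e| < r) (ϑ' : ℝ) (k : ℕ) (θ : ℝ) :
    iteratedDeriv k (fun θ : ℝ => ∫ φ in Ioo (-π) π,
        (levelChartJac μ K (e, φ + θ) : ℝ) • Ψ (frameLevel μ K (levelPoint μ K 0 θ + levelPoint μ K ρ' (ϑ' + θ) - levelPoint μ K e (φ + θ)))) θ =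
      ∫ φ in Ioo (-π) π, iteratedDeriv k (fun θ : ℝ =>
        (levelChartJac μ K (e, φ + θ) : ℝ) • Ψ (frameLevel μ K (levelPoint μ K 0 θ + levelPoint μ K ρ' (ϑ' + θ) - levelPoint μ K e (φ + θ)))) θ :=
  iteratedDeriv_loopCircleIntegral_eq (contDiff_loopIntegrand_pp B hA hADt hlo hhi hΨ hρ' he ϑ') k θ

/-- The co-moving pp loop integral is `C^∞` in the base angle. -/
theorem contDiff_loopIntegral_pp {Ψ : ℝ → ℂ} (hΨ : ContDiff ℝ ∞ Ψ) {ρ' e : ℝ} (hρ' : |ρ'| < r) (he : |e| < r) (ϑ' : ℝ) :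
    ContDiff ℝ ∞ fun θ : ℝ => ∫ φ in Ioo (-π) π,
      (levelChartJac μ K (e, φ + θ) : ℝ) • Ψ (frameLevel μ K (levelPoint μ K 0 θ + levelPoint μ K ρ' (ϑ' + θ) - levelPoint μ K e (φ + θ))) :=
  contDiff_loopCircleIntegral (contDiff_loopIntegrand_pp B hA hADt hlo hhi hΨ hρ' he ϑ')

/-- **Majorants pass under the co-moving pp loop integral**: a pointwise integrable bound `m φ` of the integrand's `k`-jet gives `‖∂ᵏ_θ I(e;θ)‖ ≤ ∫ m`. -/
theorem norm_iteratedDeriv_loopIntegral_pp_le {Ψ : ℝ → ℂ} (hΨ : ContDiff ℝ ∞ Ψ) {ρ' e : ℝ} (hρ' : |ρ'| < r) (he : |e| < r) (ϑ' : ℝ) (k : ℕ) (θ : ℝ)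
    {m : ℝ → ℝ} (hmi : IntegrableOn m (Ioo (-π) π))
    (hm : ∀ φ ∈ Ioo (-π) π, ‖iteratedDeriv k (fun θ : ℝ =>
      (levelChartJac μ K (e, φ + θ) : ℝ) • Ψ (frameLevel μ K (levelPoint μ K 0 θ + levelPoint μ K ρ' (ϑ' + θ) - levelPoint μ K e (φ + θ)))) θ‖ ≤ m φ) :
    ‖iteratedDeriv k (fun θ : ℝ => ∫ φ in Ioo (-π) π,
        (levelChartJac μ K (e, φ + θ) : ℝ) • Ψ (frameLevel μ K (levelPoint μ K 0 θ + levelPoint μ K ρ' (ϑ' + θ) - levelPoint μ K e (φ + θ)))) θ‖ ≤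
      ∫ φ in Ioo (-π) π, m φ :=
  norm_iteratedDeriv_loopCircleIntegral_le (contDiff_loopIntegrand_pp B hA hADt hlo hhi hΨ hρ' he ϑ') k θ hmi hm

/-- **The cut-off pp integrand is jointly `C^∞` in (loop angle, level, base angle)**: for a smooth level profile `f` with `tsupport f ⊆ (−r, r)`,
`(φ,(e,θ)) ↦ f(e)·(J(e,φ+θ)•Ψ(ē(e,φ;ρ′,ϑ′,θ)))` is `C^∞` on all of `ℝ × ℝ²` (strip lemma: `J` and `Φ` are jointly smooth on the open tube). -/
theorem contDiff_levelIntegrand_pp {f : ℝ → ℂ} (hf : ContDiff ℝ ∞ f) (hfsupp : tsupport f ⊆ Ioo (-r) r) {Ψ : ℝ → ℂ} (hΨ : ContDiff ℝ ∞ Ψ)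
    {ρ' : ℝ} (hρ' : |ρ'| < r) (ϑ' : ℝ) :
    ContDiff ℝ ∞ fun q : ℝ × (ℝ × ℝ) => f q.2.1 * ((levelChartJac μ K (q.2.1, q.1 + q.2.2) : ℝ) •
      Ψ (frameLevel μ K (levelPoint μ K 0 q.2.2 + levelPoint μ K ρ' (ϑ' + q.2.2) - levelPoint μ K q.2.1 (q.1 + q.2.2)))) := by
  have h0 : |(0 : ℝ)| < r := by rw [abs_zero]; exact (abs_nonneg ρ').trans_lt hρ'
  have hT : IsOpen ({ρ : ℝ | |ρ| < r} ×ˢ (univ : Set ℝ)) := (isOpen_lt continuous_abs continuous_const).prod isOpen_univ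
  have hl : ∀ {x : ℝ}, |x| < r → ContDiff ℝ ∞ (levelPoint μ K x) := fun hx => contDiff_levelPoint_angle B hA hADt hlo hhi hx
  -- the chart map `q ↦ (q.2.1, q.1 + q.2.2)` into the tube
  have hc : ContDiff ℝ ∞ fun q : ℝ × (ℝ × ℝ) => ((q.2.1, q.1 + q.2.2) : ℝ × ℝ) :=
    (contDiff_fst.comp contDiff_snd).prodMk (contDiff_fst.add (contDiff_snd.comp contDiff_snd))
  refine contDiff_mul_of_tsupport_subset_strip (ℓ := fun q : ℝ × (ℝ × ℝ) => q.2.1) (contDiff_fst.comp contDiff_snd) (fun q hq => ?_) hf hfsupp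
  have hmem : ((q.2.1, q.1 + q.2.2) : ℝ × ℝ) ∈ {ρ : ℝ | |ρ| < r} ×ˢ (univ : Set ℝ) := mk_mem_prod hq (mem_univ _)
  have hJ : ContDiffAt ℝ ∞ (fun q : ℝ × (ℝ × ℝ) => levelChartJac μ K (q.2.1, q.1 + q.2.2)) q := by
    exact ContDiffAt.comp (g := levelChartJac μ K) (f := fun q : ℝ × (ℝ × ℝ) => ((q.2.1, q.1 + q.2.2) : ℝ × ℝ)) q
      ((contDiffOn_levelChartJac B hA hADt hlo hhi).contDiffAt (hT.mem_nhds hmem)) hc.contDiffAt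
  have hΦ : ContDiffAt ℝ ∞ (fun q : ℝ × (ℝ × ℝ) => levelPoint μ K q.2.1 (q.1 + q.2.2)) q := by
    exact ContDiffAt.comp (g := fun p : ℝ × ℝ => levelPoint μ K p.1 p.2) (f := fun q : ℝ × (ℝ × ℝ) => ((q.2.1, q.1 + q.2.2) : ℝ × ℝ)) q
      ((contDiffOn_levelPoint B hA hADt hlo hhi (m := ⊤)).contDiffAt (hT.mem_nhds hmem)) hc.contDiffAt
  have hE : ContDiffAt ℝ ∞ (fun q : ℝ × (ℝ × ℝ) =>
      levelPoint μ K 0 q.2.2 + levelPoint μ K ρ' (ϑ' + q.2.2) - levelPoint μ K q.2.1 (q.1 + q.2.2)) q :=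
    ((((hl h0).comp (contDiff_snd.comp contDiff_snd)).add
      ((hl hρ').comp (contDiff_const.add (contDiff_snd.comp contDiff_snd)))).contDiffAt).sub hΦ
  exact hJ.smul ((hΨ.comp (EngineV8.contDiff_frameLevel μ K)).contDiffAt.comp q hE)

/-- **`(e, θ) ↦ f(e)·I(e;θ)` is jointly `C^∞`** (the cut-off loop integral as a two-parameter parametric integral). -/
theorem contDiff_levelLoopIntegral_pp {f : ℝ → ℂ} (hf : ContDiff ℝ ∞ f) (hfsupp : tsupport f ⊆ Ioo (-r) r) {Ψ : ℝ → ℂ} (hΨ : ContDiff ℝ ∞ Ψ)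
    {ρ' : ℝ} (hρ' : |ρ'| < r) (ϑ' : ℝ) :
    ContDiff ℝ ∞ fun p : ℝ × ℝ => f p.1 * ∫ φ in Ioo (-π) π,
      (levelChartJac μ K (p.1, φ + p.2) : ℝ) • Ψ (frameLevel μ K (levelPoint μ K 0 p.2 + levelPoint μ K ρ' (ϑ' + p.2) - levelPoint μ K p.1 (φ + p.2))) := by
  have h := contDiff_loopCircleIntegral_param (contDiff_levelIntegrand_pp B hA hADt hlo hhi hf hfsupp hΨ hρ' ϑ')
  have heq : (fun p : ℝ × ℝ => f p.1 * ∫ φ in Ioo (-π) π, (levelChartJac μ K (p.1, φ + p.2) : ℝ) •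
      Ψ (frameLevel μ K (levelPoint μ K 0 p.2 + levelPoint μ K ρ' (ϑ' + p.2) - levelPoint μ K p.1 (φ + p.2)))) =
      fun p : ℝ × ℝ => ∫ φ in Ioo (-π) π, f p.1 * ((levelChartJac μ K (p.1, φ + p.2) : ℝ) •
        Ψ (frameLevel μ K (levelPoint μ K 0 p.2 + levelPoint μ K ρ' (ϑ' + p.2) - levelPoint μ K p.1 (φ + p.2)))) :=
    funext fun p => (integral_const_mul _ _).symm
  rw [heq]
  exact h

/-- **EVERY BASE-ANGLE DERIVATIVE OF THE TUBE PIECE** (pp): for a smooth level profile `f` with `tsupport f ⊆ (−r, r)`, smooth `Ψ`, `|ρ′| < r`,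
`∂ᵏ_θ ∫_{(−r,r)} f(e)·(∫_{(−π,π)} J(e,φ+θ)•Ψ(ē) dφ) de = ∫_{(−r,r)} f(e)·(∫_{(−π,π)} ∂ᵏ_θ[J(e,φ+θ)•Ψ(ē)](θ) dφ) de` for every `k`. -/
theorem iteratedDeriv_levelIntegral_pp_eq {f : ℝ → ℂ} (hf : ContDiff ℝ ∞ f) (hfsupp : tsupport f ⊆ Ioo (-r) r) {Ψ : ℝ → ℂ} (hΨ : ContDiff ℝ ∞ Ψ)
    {ρ' : ℝ} (hρ' : |ρ'| < r) (ϑ' : ℝ) (k : ℕ) (θ : ℝ) :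
    iteratedDeriv k (fun θ : ℝ => ∫ e in Ioo (-r) r, f e * ∫ φ in Ioo (-π) π,
        (levelChartJac μ K (e, φ + θ) : ℝ) • Ψ (frameLevel μ K (levelPoint μ K 0 θ + levelPoint μ K ρ' (ϑ' + θ) - levelPoint μ K e (φ + θ)))) θ =
      ∫ e in Ioo (-r) r, f e * ∫ φ in Ioo (-π) π, iteratedDeriv k (fun θ : ℝ =>
        (levelChartJac μ K (e, φ + θ) : ℝ) • Ψ (frameLevel μ K (levelPoint μ K 0 θ + levelPoint μ K ρ' (ϑ' + θ) - levelPoint μ K e (φ + θ)))) θ := by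
  have hG := contDiff_levelLoopIntegral_pp B hA hADt hlo hhi hf hfsupp hΨ hρ' ϑ'
  rw [iteratedDeriv_levelIntervalIntegral_eq (-r) r hG k θ]
  refine setIntegral_congr_fun measurableSet_Ioo fun e he => ?_
  have he' : |e| < r := abs_lt.2 he
  have hI := contDiff_loopIntegral_pp B hA hADt hlo hhi hΨ hρ' he' ϑ'
  show iteratedDeriv k (fun θ : ℝ => f e * ∫ φ in Ioo (-π) π,
      (levelChartJac μ K (e, φ + θ) : ℝ) • Ψ (frameLevel μ K (levelPoint μ K 0 θ + levelPoint μ K ρ' (ϑ' + θ) - levelPoint μ K e (φ + θ)))) θ = _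
  rw [iteratedDeriv_const_mul (f e) (hI.contDiffAt.of_le (by exact_mod_cast (le_top : (k : ℕ∞) ≤ ⊤))), iteratedDeriv_loopIntegral_pp_eq B hA hADt hlo hhi hΨ hρ' he' ϑ' k θ]

/-- The tube piece is `C^∞` in the base angle. -/
theorem contDiff_levelIntegral_pp {f : ℝ → ℂ} (hf : ContDiff ℝ ∞ f) (hfsupp : tsupport f ⊆ Ioo (-r) r) {Ψ : ℝ → ℂ} (hΨ : ContDiff ℝ ∞ Ψ)
    {ρ' : ℝ} (hρ' : |ρ'| < r) (ϑ' : ℝ) :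
    ContDiff ℝ ∞ fun θ : ℝ => ∫ e in Ioo (-r) r, f e * ∫ φ in Ioo (-π) π,
      (levelChartJac μ K (e, φ + θ) : ℝ) • Ψ (frameLevel μ K (levelPoint μ K 0 θ + levelPoint μ K ρ' (ϑ' + θ) - levelPoint μ K e (φ + θ))) :=
  contDiff_levelIntervalIntegral (-r) r (contDiff_levelLoopIntegral_pp B hA hADt hlo hhi hf hfsupp hΨ hρ' ϑ')

end PP

/-! ## §3 The ph twins (partner `Φ(e,φ+θ) − (Φ(0,θ) − Φ(ρ′,ϑ′+θ))`) -/

section PH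

variable {a b : ℝ} (B : BandBounds a b) {K : TrigPolyC4v} {A : ℝ}
  (hA : ∀ p : Momentum, ∀ j ≤ 2, ‖iteratedFDeriv ℝ j (frameShift K) p‖ ≤ A) (hADt : 2 * A < B.Dtmin)
  {μ r : ℝ} (hlo : a < μ - r - A) (hhi : μ + r + A < b)
include B hA hADt hlo hhi

/-- The ph loop integrand is jointly `C^∞` in (loop angle, base angle). -/
theorem contDiff_loopIntegrand_ph {Ψ : ℝ → ℂ} (hΨ : ContDiff ℝ ∞ Ψ) {ρ' e : ℝ} (hρ' : |ρ'| < r) (he : |e| < r) (ϑ' : ℝ) :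
    ContDiff ℝ ∞ fun q : ℝ × ℝ => (levelChartJac μ K (e, q.1 + q.2) : ℝ) •
      Ψ (frameLevel μ K (levelPoint μ K e (q.1 + q.2) - (levelPoint μ K 0 q.2 - levelPoint μ K ρ' (ϑ' + q.2)))) := by
  have h0 : |(0 : ℝ)| < r := by rw [abs_zero]; exact (abs_nonneg e).trans_lt he
  have hJ : ContDiff ℝ ∞ fun q : ℝ × ℝ => levelChartJac μ K (e, q.1 + q.2) :=
    (contDiff_levelChartJac_angle B hA hADt hlo hhi he).comp (contDiff_fst.add contDiff_snd)
  have hl : ∀ {x : ℝ}, |x| < r → ContDiff ℝ ∞ (levelPoint μ K x) := fun hx => contDiff_levelPoint_angle B hA hADt hlo hhi hx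
  have hE : ContDiff ℝ ∞ fun q : ℝ × ℝ => levelPoint μ K e (q.1 + q.2) - (levelPoint μ K 0 q.2 - levelPoint μ K ρ' (ϑ' + q.2)) :=
    ((hl he).comp (contDiff_fst.add contDiff_snd)).sub (((hl h0).comp contDiff_snd).sub ((hl hρ').comp (contDiff_const.add contDiff_snd)))
  exact hJ.smul (hΨ.comp ((EngineV8.contDiff_frameLevel μ K).comp hE))

/-- **Every base-angle derivative of the co-moving ph loop integral is the integral of the integrand's jet.** -/
theorem iteratedDeriv_loopIntegral_ph_eq {Ψ : ℝ → ℂ} (hΨ : ContDiff ℝ ∞ Ψ) {ρ' e : ℝ} (hρ' : |ρ'| < r) (he : |e| < r) (ϑ' : ℝ) (k : ℕ) (θ : ℝ) :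
    iteratedDeriv k (fun θ : ℝ => ∫ φ in Ioo (-π) π,
        (levelChartJac μ K (e, φ + θ) : ℝ) • Ψ (frameLevel μ K (levelPoint μ K e (φ + θ) - (levelPoint μ K 0 θ - levelPoint μ K ρ' (ϑ' + θ))))) θ =
      ∫ φ in Ioo (-π) π, iteratedDeriv k (fun θ : ℝ =>
        (levelChartJac μ K (e, φ + θ) : ℝ) • Ψ (frameLevel μ K (levelPoint μ K e (φ + θ) - (levelPoint μ K 0 θ - levelPoint μ K ρ' (ϑ' + θ))))) θ :=
  iteratedDeriv_loopCircleIntegral_eq (contDiff_loopIntegrand_ph B hA hADt hlo hhi hΨ hρ' he ϑ') k θ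

/-- The co-moving ph loop integral is `C^∞` in the base angle. -/
theorem contDiff_loopIntegral_ph {Ψ : ℝ → ℂ} (hΨ : ContDiff ℝ ∞ Ψ) {ρ' e : ℝ} (hρ' : |ρ'| < r) (he : |e| < r) (ϑ' : ℝ) :
    ContDiff ℝ ∞ fun θ : ℝ => ∫ φ in Ioo (-π) π,
      (levelChartJac μ K (e, φ + θ) : ℝ) • Ψ (frameLevel μ K (levelPoint μ K e (φ + θ) - (levelPoint μ K 0 θ - levelPoint μ K ρ' (ϑ' + θ)))) :=
  contDiff_loopCircleIntegral (contDiff_loopIntegrand_ph B hA hADt hlo hhi hΨ hρ' he ϑ')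

/-- Majorants pass under the co-moving ph loop integral. -/
theorem norm_iteratedDeriv_loopIntegral_ph_le {Ψ : ℝ → ℂ} (hΨ : ContDiff ℝ ∞ Ψ) {ρ' e : ℝ} (hρ' : |ρ'| < r) (he : |e| < r) (ϑ' : ℝ) (k : ℕ) (θ : ℝ)
    {m : ℝ → ℝ} (hmi : IntegrableOn m (Ioo (-π) π))
    (hm : ∀ φ ∈ Ioo (-π) π, ‖iteratedDeriv k (fun θ : ℝ =>
      (levelChartJac μ K (e, φ + θ) : ℝ) • Ψ (frameLevel μ K (levelPoint μ K e (φ + θ) - (levelPoint μ K 0 θ - levelPoint μ K ρ' (ϑ' + θ))))) θ‖ ≤ m φ) :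
    ‖iteratedDeriv k (fun θ : ℝ => ∫ φ in Ioo (-π) π,
        (levelChartJac μ K (e, φ + θ) : ℝ) • Ψ (frameLevel μ K (levelPoint μ K e (φ + θ) - (levelPoint μ K 0 θ - levelPoint μ K ρ' (ϑ' + θ))))) θ‖ ≤
      ∫ φ in Ioo (-π) π, m φ :=
  norm_iteratedDeriv_loopCircleIntegral_le (contDiff_loopIntegrand_ph B hA hADt hlo hhi hΨ hρ' he ϑ') k θ hmi hm

/-- The cut-off ph integrand is jointly `C^∞` in (loop angle, level, base angle). -/
theorem contDiff_levelIntegrand_ph {f : ℝ → ℂ} (hf : ContDiff ℝ ∞ f) (hfsupp : tsupport f ⊆ Ioo (-r) r) {Ψ : ℝ → ℂ} (hΨ : ContDiff ℝ ∞ Ψ)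
    {ρ' : ℝ} (hρ' : |ρ'| < r) (ϑ' : ℝ) :
    ContDiff ℝ ∞ fun q : ℝ × (ℝ × ℝ) => f q.2.1 * ((levelChartJac μ K (q.2.1, q.1 + q.2.2) : ℝ) •
      Ψ (frameLevel μ K (levelPoint μ K q.2.1 (q.1 + q.2.2) - (levelPoint μ K 0 q.2.2 - levelPoint μ K ρ' (ϑ' + q.2.2))))) := by
  have h0 : |(0 : ℝ)| < r := by rw [abs_zero]; exact (abs_nonneg ρ').trans_lt hρ'
  have hT : IsOpen ({ρ : ℝ | |ρ| < r} ×ˢ (univ : Set ℝ)) := (isOpen_lt continuous_abs continuous_const).prod isOpen_univ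
  have hl : ∀ {x : ℝ}, |x| < r → ContDiff ℝ ∞ (levelPoint μ K x) := fun hx => contDiff_levelPoint_angle B hA hADt hlo hhi hx
  have hc : ContDiff ℝ ∞ fun q : ℝ × (ℝ × ℝ) => ((q.2.1, q.1 + q.2.2) : ℝ × ℝ) :=
    (contDiff_fst.comp contDiff_snd).prodMk (contDiff_fst.add (contDiff_snd.comp contDiff_snd))
  refine contDiff_mul_of_tsupport_subset_strip (ℓ := fun q : ℝ × (ℝ × ℝ) => q.2.1) (contDiff_fst.comp contDiff_snd) (fun q hq => ?_) hf hfsupp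
  have hmem : ((q.2.1, q.1 + q.2.2) : ℝ × ℝ) ∈ {ρ : ℝ | |ρ| < r} ×ˢ (univ : Set ℝ) := mk_mem_prod hq (mem_univ _)
  have hJ : ContDiffAt ℝ ∞ (fun q : ℝ × (ℝ × ℝ) => levelChartJac μ K (q.2.1, q.1 + q.2.2)) q := by
    exact ContDiffAt.comp (g := levelChartJac μ K) (f := fun q : ℝ × (ℝ × ℝ) => ((q.2.1, q.1 + q.2.2) : ℝ × ℝ)) q
      ((contDiffOn_levelChartJac B hA hADt hlo hhi).contDiffAt (hT.mem_nhds hmem)) hc.contDiffAt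
  have hΦ : ContDiffAt ℝ ∞ (fun q : ℝ × (ℝ × ℝ) => levelPoint μ K q.2.1 (q.1 + q.2.2)) q := by
    exact ContDiffAt.comp (g := fun p : ℝ × ℝ => levelPoint μ K p.1 p.2) (f := fun q : ℝ × (ℝ × ℝ) => ((q.2.1, q.1 + q.2.2) : ℝ × ℝ)) q
      ((contDiffOn_levelPoint B hA hADt hlo hhi (m := ⊤)).contDiffAt (hT.mem_nhds hmem)) hc.contDiffAt
  have hE : ContDiffAt ℝ ∞ (fun q : ℝ × (ℝ × ℝ) =>
      levelPoint μ K q.2.1 (q.1 + q.2.2) - (levelPoint μ K 0 q.2.2 - levelPoint μ K ρ' (ϑ' + q.2.2))) q :=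
    hΦ.sub (((hl h0).comp (contDiff_snd.comp contDiff_snd)).sub
      ((hl hρ').comp (contDiff_const.add (contDiff_snd.comp contDiff_snd)))).contDiffAt
  exact hJ.smul ((hΨ.comp (EngineV8.contDiff_frameLevel μ K)).contDiffAt.comp q hE)

/-- `(e, θ) ↦ f(e)·I_ph(e;θ)` is jointly `C^∞`. -/
theorem contDiff_levelLoopIntegral_ph {f : ℝ → ℂ} (hf : ContDiff ℝ ∞ f) (hfsupp : tsupport f ⊆ Ioo (-r) r) {Ψ : ℝ → ℂ} (hΨ : ContDiff ℝ ∞ Ψ)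
    {ρ' : ℝ} (hρ' : |ρ'| < r) (ϑ' : ℝ) :
    ContDiff ℝ ∞ fun p : ℝ × ℝ => f p.1 * ∫ φ in Ioo (-π) π,
      (levelChartJac μ K (p.1, φ + p.2) : ℝ) • Ψ (frameLevel μ K (levelPoint μ K p.1 (φ + p.2) - (levelPoint μ K 0 p.2 - levelPoint μ K ρ' (ϑ' + p.2)))) := by
  have h := contDiff_loopCircleIntegral_param (contDiff_levelIntegrand_ph B hA hADt hlo hhi hf hfsupp hΨ hρ' ϑ')
  have heq : (fun p : ℝ × ℝ => f p.1 * ∫ φ in Ioo (-π) π, (levelChartJac μ K (p.1, φ + p.2) : ℝ) •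
      Ψ (frameLevel μ K (levelPoint μ K p.1 (φ + p.2) - (levelPoint μ K 0 p.2 - levelPoint μ K ρ' (ϑ' + p.2))))) =
      fun p : ℝ × ℝ => ∫ φ in Ioo (-π) π, f p.1 * ((levelChartJac μ K (p.1, φ + p.2) : ℝ) •
        Ψ (frameLevel μ K (levelPoint μ K p.1 (φ + p.2) - (levelPoint μ K 0 p.2 - levelPoint μ K ρ' (ϑ' + p.2))))) :=
    funext fun p => (integral_const_mul _ _).symm
  rw [heq]
  exact h

/-- **Every base-angle derivative of the ph tube piece** is the level integral of the loop integral of the integrand's jet. -/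
theorem iteratedDeriv_levelIntegral_ph_eq {f : ℝ → ℂ} (hf : ContDiff ℝ ∞ f) (hfsupp : tsupport f ⊆ Ioo (-r) r) {Ψ : ℝ → ℂ} (hΨ : ContDiff ℝ ∞ Ψ)
    {ρ' : ℝ} (hρ' : |ρ'| < r) (ϑ' : ℝ) (k : ℕ) (θ : ℝ) :
    iteratedDeriv k (fun θ : ℝ => ∫ e in Ioo (-r) r, f e * ∫ φ in Ioo (-π) π,
        (levelChartJac μ K (e, φ + θ) : ℝ) • Ψ (frameLevel μ K (levelPoint μ K e (φ + θ) - (levelPoint μ K 0 θ - levelPoint μ K ρ' (ϑ' + θ))))) θ =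
      ∫ e in Ioo (-r) r, f e * ∫ φ in Ioo (-π) π, iteratedDeriv k (fun θ : ℝ =>
        (levelChartJac μ K (e, φ + θ) : ℝ) • Ψ (frameLevel μ K (levelPoint μ K e (φ + θ) - (levelPoint μ K 0 θ - levelPoint μ K ρ' (ϑ' + θ))))) θ := by
  have hG := contDiff_levelLoopIntegral_ph B hA hADt hlo hhi hf hfsupp hΨ hρ' ϑ'
  rw [iteratedDeriv_levelIntervalIntegral_eq (-r) r hG k θ]
  refine setIntegral_congr_fun measurableSet_Ioo fun e he => ?_
  have he' : |e| < r := abs_lt.2 he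
  have hI := contDiff_loopIntegral_ph B hA hADt hlo hhi hΨ hρ' he' ϑ'
  show iteratedDeriv k (fun θ : ℝ => f e * ∫ φ in Ioo (-π) π,
      (levelChartJac μ K (e, φ + θ) : ℝ) • Ψ (frameLevel μ K (levelPoint μ K e (φ + θ) - (levelPoint μ K 0 θ - levelPoint μ K ρ' (ϑ' + θ))))) θ = _
  rw [iteratedDeriv_const_mul (f e) (hI.contDiffAt.of_le (by exact_mod_cast (le_top : (k : ℕ∞) ≤ ⊤))), iteratedDeriv_loopIntegral_ph_eq B hA hADt hlo hhi hΨ hρ' he' ϑ' k θ]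

/-- The ph tube piece is `C^∞` in the base angle. -/
theorem contDiff_levelIntegral_ph {f : ℝ → ℂ} (hf : ContDiff ℝ ∞ f) (hfsupp : tsupport f ⊆ Ioo (-r) r) {Ψ : ℝ → ℂ} (hΨ : ContDiff ℝ ∞ Ψ)
    {ρ' : ℝ} (hρ' : |ρ'| < r) (ϑ' : ℝ) :
    ContDiff ℝ ∞ fun θ : ℝ => ∫ e in Ioo (-r) r, f e * ∫ φ in Ioo (-π) π,
      (levelChartJac μ K (e, φ + θ) : ℝ) • Ψ (frameLevel μ K (levelPoint μ K e (φ + θ) - (levelPoint μ K 0 θ - levelPoint μ K ρ' (ϑ' + θ)))) :=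
  contDiff_levelIntervalIntegral (-r) r (contDiff_levelLoopIntegral_ph B hA hADt hlo hhi hf hfsupp hΨ hρ' ϑ')

end PH

end Summit.HubbardSuperconductivity.HubbardSuperconductivity.Theorems.C4a

end
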